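import Literature.Analysis.FluidPDE.TimeAverageMeasureBasic
import HarnessLib

/-!
# Rising-sun selection for long-time averages: sunrise and sunset instants

Analysis/FluidPDE support file (all proved; real-variable only) for the long-time averages of
`TurbWave0` (`timeMean g T = T⁻¹∫₀ᵀ g`, `longTimeAvgSup = limsup`, `longTimeAvgInf = liminf` of
the running means; Doering–Foias 2002 §2). The content is F. Riesz's rising-sun selection applied
to the primitive `F(u) = ∫₀ᵘ φ - a·u` of a signal `φ` continuous on `[0, ∞)`:

* de-junking: for a signal bounded on `(0, ∞)` the running means are bounded, so
  `longTimeAvgSup φ < b` (resp. `a < longTimeAvgInf φ`) gives EVENTUALLY `∫₀ᵘ φ < b·u`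
  (resp. `a·u < ∫₀ᵘ φ`) — `eventually_integral_lt_of_longTimeAvgSup_lt`,
  `eventually_lt_integral_of_lt_longTimeAvgInf`;
* `rising_sun` / `setting_sun`: a minimiser (maximiser) `s` of `F` on a compact window `[t₀, R]`
  beyond which `F` stays above (below) `F t₀` is a SUNRISE (SUNSET) instant — every forward
  window `[s, s+T]` has mean `≥ a` (`≤ b`), with no waiting time;
* `exists_sunrise` / `exists_sunset`: a `liminf` floor `a < longTimeAvgInf φ` (a `limsup` budget
  `longTimeAvgSup φ < b`) of a bounded continuous signal yields such an instant beyond any `t₀ ≥ 0`;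
* `settle_of_gap`: two signals `e ≤ B₁`, `D ≥ 0` with a `D`-sunrise instant `s_D` (level `a`) and an
  `e`-sunset instant `s_e` (level `b ≥ 0`) at distance `≤ Δ` settle jointly from `min s_D s_e`:
  every window of length `T ≥ max 1 (Δ · max (a/(a-ε₁)) (B₁/(E₁-b)))` has `D`-mean `≥ ε₁` and
  `e`-mean `≤ E₁` (explicit gap arithmetic).

These are the selection half of "uniform equilibration" arguments for dissipative systems: the
waiting time of ONE time-averaged observable is always removable by choosing the starting instant;
for two observables what remains is a bound on the sunrise–sunset gap.

## Mathlib search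

Used: `Filter.eventually_lt_of_limsup_lt`, `Filter.eventually_lt_of_lt_liminf` (with the explicit
boundedness witnesses `isBoundedUnder_le_timeMean` / `isBoundedUnder_ge_timeMean` of
`TimeAverageMeasureBasic` — the `isBoundedDefault` auto-param does not fire on `ℝ`),
`IsCompact.exists_isMinOn`, `intervalIntegral.continuousOn_primitive_interval'`,
`intervalIntegral.integral_interval_sub_left`, `intervalIntegral.integral_add_adjacent_intervals`,
`intervalIntegral.integral_mono_on`. Mathlib has the rising-sun lemma only in its measure-theoretic
(Vitali/differentiation) guise, not this elementary selection form (searched `rising_sun`,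
`sunrise`, `isMinOn primitive`).

## References

* F. Riesz, *Sur un théorème de maximum de MM. Hardy et Littlewood*, J. London Math. Soc. 7 (1932)
  (rising-sun lemma). [folklore form used here]
* C. R. Doering, C. Foias, *Energy dissipation in body-forced turbulence*, J. Fluid Mech. 467
  (2002), §2 (long-time averages). [DoeringFoias2002]
-/

noncomputable section

open _root_.MeasureTheory _root_.Set _root_.Filter
open scoped _root_.Topology

namespace Literature.Analysis.FluidPDE

/-! ### Interval integrability on `[0, ∞)` -/

/-- Interval integrability of a function continuous on `[0, ∞)` over `[a, b]` with
`0 ≤ a ≤ b`. [folklore] -/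
theorem intervalIntegrable_of_continuousOn_Ici_of_le {φ : ℝ → ℝ} (hφ : ContinuousOn φ (Ici 0))
    {a b : ℝ} (ha : 0 ≤ a) (hab : a ≤ b) : IntervalIntegrable φ volume a b :=
  (hφ.mono (by rw [uIcc_of_le hab]; exact fun t ht => ha.trans ht.1)).intervalIntegrable

/-- Interval integrability of a function continuous on `[0, ∞)` between any two points of
`[0, ∞)`. [folklore] -/
theorem intervalIntegrable_of_continuousOn_Ici_of_nonneg {φ : ℝ → ℝ}
    (hφ : ContinuousOn φ (Ici 0)) {a b : ℝ} (ha : 0 ≤ a) (hb : 0 ≤ b) :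
    IntervalIntegrable φ volume a b := by
  rcases le_total a b with hab | hba
  · exact intervalIntegrable_of_continuousOn_Ici_of_le hφ ha hab
  · exact (intervalIntegrable_of_continuousOn_Ici_of_le hφ hb hba).symm

/-- Window integrals after a time shift: `∫₀ᵀ φ(t + s) dt = ∫ₛ^{s+T} φ`. [folklore] -/
theorem integral_comp_add_right_zero (φ : ℝ → ℝ) (s T : ℝ) :
    ∫ t in (0 : ℝ)..T, φ (t + s) = ∫ t in s..(s + T), φ t := by
  rw [intervalIntegral.integral_comp_add_right, zero_add, add_comm T s]

/-! ### De-junking: eventual linear bounds on the primitive from `limsup` / `liminf` of the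
running means of a bounded signal -/

/-- A `limsup` budget on the running means of a signal bounded on `(0, ∞)` gives, eventually,
`∫₀ᵘ φ < b·u`. (The boundedness makes `Filter.eventually_lt_of_limsup_lt` honest: the running
means are bounded, `isBoundedUnder_le_timeMean`.) [folklore] -/
theorem eventually_integral_lt_of_longTimeAvgSup_lt {φ : ℝ → ℝ} {b C : ℝ}
    (hsup : longTimeAvgSup φ < b) (hbd : ∀ t, 0 < t → |φ t| ≤ C) :
    ∀ᶠ u in atTop, (∫ t in (0 : ℝ)..u, φ t) < b * u := by
  have hev : ∀ᶠ u in atTop, timeMean φ u < b :=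
    Filter.eventually_lt_of_limsup_lt hsup (isBoundedUnder_le_timeMean hbd)
  filter_upwards [hev, eventually_gt_atTop 0] with u hu hu0
  unfold timeMean at hu
  rw [inv_mul_lt_iff₀ hu0] at hu
  linarith [mul_comm u b]

/-- A `liminf` floor on the running means of a signal bounded on `(0, ∞)` gives, eventually,
`a·u < ∫₀ᵘ φ`. [folklore] -/
theorem eventually_lt_integral_of_lt_longTimeAvgInf {φ : ℝ → ℝ} {a C : ℝ}
    (hinf : a < longTimeAvgInf φ) (hbd : ∀ t, 0 < t → |φ t| ≤ C) :
    ∀ᶠ u in atTop, a * u < ∫ t in (0 : ℝ)..u, φ t := by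
  have hev : ∀ᶠ u in atTop, a < timeMean φ u :=
    Filter.eventually_lt_of_lt_liminf hinf (isBoundedUnder_ge_timeMean hbd)
  filter_upwards [hev, eventually_gt_atTop 0] with u hu hu0
  unfold timeMean at hu
  rw [lt_inv_mul_iff₀ hu0] at hu
  linarith [mul_comm u a]

/-! ### Rising sun / setting sun (F. Riesz) -/

/-- **Rising-sun selection** (compact form). If `F(u) = ∫₀ᵘ φ - a·u` satisfies `F(t₀) ≤ F(u)`
for all `u ≥ R`, then a minimiser `s ∈ [t₀, R]` of `F` on `[t₀, R]` is a SUNRISE INSTANT of the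
signal `φ` (continuous on `[0, ∞)`) at level `a`: every forward window from `s` has mean `≥ a`,
with no waiting time. [folklore] -/
theorem rising_sun {φ : ℝ → ℝ} {a t₀ R : ℝ} (ht₀ : 0 ≤ t₀) (hR : t₀ ≤ R)
    (hφ : ContinuousOn φ (Ici 0))
    (hev : ∀ u, R ≤ u → (∫ t in (0 : ℝ)..t₀, φ t) - a * t₀ ≤ (∫ t in (0 : ℝ)..u, φ t) - a * u) :
    ∃ s, t₀ ≤ s ∧ s ≤ R ∧ ∀ T, 0 ≤ T → a * T ≤ ∫ t in s..(s + T), φ t := by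
  set F : ℝ → ℝ := fun u => (∫ t in (0 : ℝ)..u, φ t) - a * u with hF
  -- `F` is continuous on `[t₀, R]`
  have hprim : ContinuousOn (fun u => ∫ t in (0 : ℝ)..u, φ t) (Icc t₀ R) := by
    have h := intervalIntegral.continuousOn_primitive_interval' (μ := volume) (f := φ)
      (b₁ := 0) (b₂ := R) (a := 0)
      (intervalIntegrable_of_continuousOn_Ici_of_le hφ le_rfl (ht₀.trans hR)) (left_mem_uIcc)
    rw [uIcc_of_le (ht₀.trans hR)] at h
    exact h.mono (Icc_subset_Icc_left ht₀)
  have hFc : ContinuousOn F (Icc t₀ R) := hprim.sub (continuousOn_const.mul continuousOn_id)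
  obtain ⟨s, hs, hmin⟩ :=
    (isCompact_Icc (a := t₀) (b := R)).exists_isMinOn (nonempty_Icc.2 hR) hFc
  refine ⟨s, hs.1, hs.2, fun T hT => ?_⟩
  have hs0 : 0 ≤ s := ht₀.trans hs.1
  -- `F s ≤ F (s + T)` in both cases `s + T ≤ R` / `R ≤ s + T`
  have hkey : F s ≤ F (s + T) := by
    rcases le_total (s + T) R with h | h
    · exact hmin ⟨hs.1.trans (le_add_of_nonneg_right hT), h⟩
    · exact (hmin ⟨le_rfl, hR⟩).trans (hev _ h)
  have hsplit :
      (∫ t in (0 : ℝ)..(s + T), φ t) - ∫ t in (0 : ℝ)..s, φ t = ∫ t in s..(s + T), φ t :=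
    intervalIntegral.integral_interval_sub_left
      (intervalIntegrable_of_continuousOn_Ici_of_le hφ le_rfl
        (hs0.trans (le_add_of_nonneg_right hT)))
      (intervalIntegrable_of_continuousOn_Ici_of_le hφ le_rfl hs0)
  simp only [hF] at hkey
  linarith

/-- **Setting-sun selection**: the mirror image of `rising_sun` for an upper level `b` — a
maximiser of `∫₀ᵘ φ - b·u` on `[t₀, R]` is a SUNSET INSTANT: every forward window from it has
mean `≤ b`. [folklore] -/
theorem setting_sun {φ : ℝ → ℝ} {b t₀ R : ℝ} (ht₀ : 0 ≤ t₀) (hR : t₀ ≤ R)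
    (hφ : ContinuousOn φ (Ici 0))
    (hev : ∀ u, R ≤ u → (∫ t in (0 : ℝ)..u, φ t) - b * u ≤ (∫ t in (0 : ℝ)..t₀, φ t) - b * t₀) :
    ∃ s, t₀ ≤ s ∧ s ≤ R ∧ ∀ T, 0 ≤ T → ∫ t in s..(s + T), φ t ≤ b * T := by
  obtain ⟨s, hs₁, hs₂, hsun⟩ := rising_sun (φ := fun t => -φ t) (a := -b) ht₀ hR hφ.neg
    (fun u hu => by
      simp only [intervalIntegral.integral_neg]
      linarith [hev u hu])
  refine ⟨s, hs₁, hs₂, fun T hT => ?_⟩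
  have h := hsun T hT
  simp only [intervalIntegral.integral_neg] at h
  linarith

/-- **Sunrise instant from a `liminf` floor.** If the running means of a signal `φ`, continuous
on `[0, ∞)` and bounded on `(0, ∞)`, have `liminf > a`, then beyond any `t₀ ≥ 0` there is an
instant `s` all of whose forward windows have mean `≥ a`: the waiting time of ONE time-averaged
observable is removable by the choice of the starting instant. [folklore] -/
theorem exists_sunrise {φ : ℝ → ℝ} {a C t₀ : ℝ} (hφ : ContinuousOn φ (Ici 0))
    (hbd : ∀ t, 0 < t → |φ t| ≤ C) (ha : a < longTimeAvgInf φ) (ht₀ : 0 ≤ t₀) :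
    ∃ s, t₀ ≤ s ∧ ∀ T, 0 ≤ T → a * T ≤ ∫ t in s..(s + T), φ t := by
  obtain ⟨a', haa', ha'⟩ := exists_between ha
  obtain ⟨R₀, hR₀⟩ :=
    Filter.eventually_atTop.1 (eventually_lt_integral_of_lt_longTimeAvgInf ha' hbd)
  set F₀ : ℝ := (∫ t in (0 : ℝ)..t₀, φ t) - a * t₀
  set R : ℝ := max (max R₀ t₀) (F₀ / (a' - a))
  have hgap : 0 < a' - a := sub_pos.2 haa'
  obtain ⟨s, hs, -, hsun⟩ := rising_sun (a := a) ht₀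
    ((le_max_right _ _).trans (le_max_left _ _)) hφ (fun u hu => by
      have hu₀ : R₀ ≤ u := ((le_max_left _ _).trans (le_max_left _ _)).trans hu
      have hu₁ : F₀ / (a' - a) ≤ u := (le_max_right _ _).trans hu
      have h1 : a' * u < ∫ t in (0 : ℝ)..u, φ t := hR₀ u hu₀
      have h2 : F₀ ≤ (a' - a) * u := by rwa [div_le_iff₀ hgap, mul_comm] at hu₁
      show F₀ ≤ _
      nlinarith)
  exact ⟨s, hs, hsun⟩

/-- **Sunset instant from a `limsup` budget** (mirror image of `exists_sunrise`): if the running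
means of a bounded continuous signal have `limsup < b`, then beyond any `t₀ ≥ 0` there is an
instant all of whose forward windows have mean `≤ b`. [folklore] -/
theorem exists_sunset {φ : ℝ → ℝ} {b C t₀ : ℝ} (hφ : ContinuousOn φ (Ici 0))
    (hbd : ∀ t, 0 < t → |φ t| ≤ C) (hb : longTimeAvgSup φ < b) (ht₀ : 0 ≤ t₀) :
    ∃ s, t₀ ≤ s ∧ ∀ T, 0 ≤ T → ∫ t in s..(s + T), φ t ≤ b * T := by
  obtain ⟨b', hb', hbb'⟩ := exists_between hb
  obtain ⟨R₀, hR₀⟩ :=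
    Filter.eventually_atTop.1 (eventually_integral_lt_of_longTimeAvgSup_lt hb' hbd)
  set F₀ : ℝ := (∫ t in (0 : ℝ)..t₀, φ t) - b * t₀
  set R : ℝ := max (max R₀ t₀) (-F₀ / (b - b'))
  have hgap : 0 < b - b' := sub_pos.2 hbb'
  obtain ⟨s, hs, -, hset⟩ := setting_sun (b := b) ht₀
    ((le_max_right _ _).trans (le_max_left _ _)) hφ (fun u hu => by
      have hu₀ : R₀ ≤ u := ((le_max_left _ _).trans (le_max_left _ _)).trans hu
      have hu₁ : -F₀ / (b - b') ≤ u := (le_max_right _ _).trans hu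
      have h1 : (∫ t in (0 : ℝ)..u, φ t) < b' * u := hR₀ u hu₀
      have h2 : -F₀ ≤ (b - b') * u := by rwa [div_le_iff₀ hgap, mul_comm] at hu₁
      show _ ≤ F₀
      nlinarith)
  exact ⟨s, hs, hset⟩

/-! ### Gap arithmetic: joint settling from a bounded sunrise–sunset gap -/

/-- **Settling from a bounded sunrise–sunset gap.** Let `e, D` be continuous on `[0, ∞)` with
`D ≥ 0` and `e ≤ B₁` there; let `s_D ≥ 0` be a sunrise instant of `D` at level `a > ε₁ ≥ 0` and
`s_e ≥ 0` a sunset instant of `e` at level `b`, `0 ≤ b < E₁`, with `|s_D - s_e| ≤ Δ`. Then from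
`s := min s_D s_e` every window of length `T ≥ max 1 (Δ · max (a/(a-ε₁)) (B₁/(E₁-b)))` has
`e`-mean `≤ E₁` and `D`-mean `≥ ε₁`: the segment between the two instants costs at most
`B₁·Δ` of energy integral and at most `a·Δ` of dissipation integral, which the window length
absorbs. [folklore] -/
theorem settle_of_gap {e D : ℝ → ℝ} {a b ε₁ E₁ B₁ Δ sD se : ℝ}
    (he : ContinuousOn e (Ici 0)) (hD : ContinuousOn D (Ici 0))
    (hD0 : ∀ t, 0 ≤ t → 0 ≤ D t) (heB : ∀ t, 0 ≤ t → e t ≤ B₁)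
    (hsD : 0 ≤ sD) (hse : 0 ≤ se) (hgap : |sD - se| ≤ Δ)
    (hε₁ : 0 ≤ ε₁) (hε₁a : ε₁ < a) (hb : 0 ≤ b) (hbE : b < E₁)
    (hsun : ∀ T, 0 ≤ T → a * T ≤ ∫ t in sD..(sD + T), D t)
    (hset : ∀ T, 0 ≤ T → ∫ t in se..(se + T), e t ≤ b * T) :
    ∃ s, 0 ≤ s ∧ ∀ T, max 1 (Δ * max (a / (a - ε₁)) (B₁ / (E₁ - b))) ≤ T →
      timeMean (fun t => e (t + s)) T ≤ E₁ ∧ ε₁ ≤ timeMean (fun t => D (t + s)) T := by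
  have hΔ : 0 ≤ Δ := (abs_nonneg _).trans hgap
  have ha : 0 < a := hε₁.trans_lt hε₁a
  have haε : 0 < a - ε₁ := sub_pos.2 hε₁a
  have hEb : 0 < E₁ - b := sub_pos.2 hbE
  refine ⟨min sD se, le_min hsD hse, fun T hT => ?_⟩
  have hT1 : 1 ≤ T := (le_max_left _ _).trans hT
  have hT0 : 0 < T := one_pos.trans_le hT1
  have hTΔa : Δ * (a / (a - ε₁)) ≤ T :=
    ((mul_le_mul_of_nonneg_left (le_max_left _ _) hΔ).trans (le_max_right _ _)).trans hT
  have hTΔB : Δ * (B₁ / (E₁ - b)) ≤ T :=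
    ((mul_le_mul_of_nonneg_left (le_max_right _ _) hΔ).trans (le_max_right _ _)).trans hT
  -- `Δ ≤ T` (since `a/(a-ε₁) ≥ 1`)
  have hΔT : Δ ≤ T := by
    have h1 : 1 ≤ a / (a - ε₁) := by rw [le_div_iff₀ haε]; linarith
    nlinarith
  -- clear denominators in the two threshold conditions
  have hTa : a * Δ ≤ (a - ε₁) * T := by
    have := mul_le_mul_of_nonneg_left hTΔa haε.le
    rwa [mul_div_assoc', mul_div_cancel₀ _ haε.ne', mul_comm Δ a] at this
  have hTB : B₁ * Δ ≤ (E₁ - b) * T := by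
    have := mul_le_mul_of_nonneg_left hTΔB hEb.le
    rwa [mul_div_assoc', mul_div_cancel₀ _ hEb.ne', mul_comm Δ B₁] at this
  -- the means are window integrals
  rw [timeMean, timeMean, integral_comp_add_right_zero, integral_comp_add_right_zero,
    inv_mul_le_iff₀ hT0, le_inv_mul_iff₀ hT0]
  rcases le_total sD se with hle | hle
  · -- `s = sD`, `δ := se - sD ∈ [0, Δ]`
    rw [min_eq_left hle]
    have hδ : se - sD ≤ Δ := by
      have := neg_abs_le (sD - se); linarith [abs_sub_comm sD se]
    refine ⟨?_, ?_⟩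
    · -- energy: split the window at `se`
      have hseT : se ≤ sD + T := by linarith
      have hsplit : ∫ t in sD..(sD + T), e t =
          (∫ t in sD..se, e t) + ∫ t in se..(sD + T), e t :=
        (intervalIntegral.integral_add_adjacent_intervals
          (intervalIntegrable_of_continuousOn_Ici_of_le he hsD hle)
          (intervalIntegrable_of_continuousOn_Ici_of_le he hse hseT)).symm
      have h1 : ∫ t in sD..se, e t ≤ B₁ * (se - sD) := by
        have := intervalIntegral.integral_mono_on hle
          (intervalIntegrable_of_continuousOn_Ici_of_le he hsD hle) intervalIntegrable_const
          (fun t ht => heB t (hsD.trans ht.1))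
        rwa [intervalIntegral.integral_const, smul_eq_mul, mul_comm] at this
      have h2 : ∫ t in se..(sD + T), e t ≤ b * (sD + T - se) := by
        have := hset (sD + T - se) (by linarith)
        rwa [show se + (sD + T - se) = sD + T by ring] at this
      -- `(B₁ - b)·δ ≤ (E₁ - b)·T`
      rcases le_total B₁ b with hBb | hBb
      · nlinarith
      · nlinarith
    · -- dissipation: the sunrise window itself
      have := hsun T hT0.le
      nlinarith
  · -- `s = se`, `δ := sD - se ∈ [0, Δ]`
    rw [min_eq_right hle]
    have hδ : sD - se ≤ Δ := (le_abs_self _).trans hgap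
    refine ⟨?_, ?_⟩
    · -- energy: the sunset window itself
      have := hset T hT0.le
      nlinarith
    · -- dissipation: drop `[se, sD]`, use the sunrise window of length `T - δ`
      have hsDT : sD ≤ se + T := by linarith
      have hsplit : ∫ t in se..(se + T), D t =
          (∫ t in se..sD, D t) + ∫ t in sD..(se + T), D t :=
        (intervalIntegral.integral_add_adjacent_intervals
          (intervalIntegrable_of_continuousOn_Ici_of_le hD hse hle)
          (intervalIntegrable_of_continuousOn_Ici_of_le hD hsD hsDT)).symm
      have h1 : 0 ≤ ∫ t in se..sD, D t :=
        intervalIntegral.integral_nonneg hle fun t ht => hD0 t (hse.trans ht.1)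
      have h2 : a * (se + T - sD) ≤ ∫ t in sD..(se + T), D t := by
        have := hsun (se + T - sD) (by linarith)
        rwa [show sD + (se + T - sD) = se + T by ring] at this
      nlinarith

end Literature.Analysis.FluidPDE

end
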